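import Summits.Ventures.PercRepro.GenQTypeOne
import Summits.Ventures.PercRepro.PlaneStepThree
import Summits.Ventures.PercRepro.PerFlatTransfer

/-!
# PercRepro — C-025 at `(q + 2, q)`: LEVEL `3` IS CLOSED — the balances of the types `t ≤ 2` on every plane, from
Theorem O's plane inequality `(β)` and the small-size cases (night-4, gen 0)

The re-cut residue `PerFlatResidueBelow q` asks for the balances `0 ≤ Jq M G q t` at the types `t ≤ q − 1`; only
rank-`q` FLATS enter the transfer (`rls_succ_succ_of_perFlatBelow` uses `G ∈ flatsQ M q`).  At level `q = 3` the
flats are the planes and the balances are Theorem O's per-plane inequalities in the vocabulary of `GenQBalance`: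

* `wt_le_wInf`: p2's plane weight `wt` (`1/4` on triples, `1/2` with a tie line, `1` otherwise) is at most
  `w_∞ = 1/(1 + m(B))` — a tie line is a coloop (`m ≤ 1` on `≥ 4` points by Lemma 21.1), no tie line means
  `m = 0` (a coloop `y` makes `cl(B ∖ y)` a tie line inside the plane);
* `one_add_gp_le_DFq_two`: `G` and the `G ∖ {a}` with `ρ(G ∖ {a}) = 3` are demand-free at type `2`;
* **`Jq_two_nonneg_plane`**: `0 ≤ Jq M G 3 2` on every plane of a simple matroid — exactly Theorem O's
  `(β)`: `3·(T/4 + LP/2 + R) ≥ (5/4)(T + LP + R − 1 − g′)` (`beta_ineq`, `PlaneStepThree`);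
* `Jq_one_nonneg_of_card_le_succ`: the type-`1` balance at every `q` for `g ≤ q + 1` (at most `q + 1`
  independent `q`-sets, each in deficit `1/(q + 1)`, against the surplus of `G`), the complement of
  `Jq_one_nonneg`'s threshold at `q = 3`;
* **`perFlatBelowFlat_three`**: every plane of a simple matroid satisfies `0 ≤ Jq M G 3 t` for `t ≤ 2`.

So level `3` contributes NO open statement: the `(5, 3)` row re-derives from the general machinery + `(β)`, and
the residues of `rls_succ_succ_all` start at level `4`.
-/

namespace PercRepro.GenQ

open Finset ThmH ThmO PerFlat SixFour

variable {α : Type*} [DecidableEq α] {M : Matroid α} [M.Finite]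

/-! ## Planes: `R_3 = N_3` and the weights -/

omit [DecidableEq α] in
/-- `Rq M G 3 = N3 M G`. -/
theorem Rq_three_eq_N3 (G : Finset α) : Rq M G 3 = N3 M G := by
  unfold Rq N3
  simp only [Nat.cast_ofNat]

/-- **p2's plane weight is at most `w_∞`** on the rank-`3` subsets of a plane of a simple matroid. -/
theorem wt_le_wInf (hs : Simple M) {G B : Finset α} (hG : G ∈ planes M) (hB : B ∈ N3 M G) :
    wt M G B ≤ wInf M B := by
  classical
  have hG' := mem_planes.1 hG
  have hB' : B ⊆ G ∧ M.eRk (B : Set α) = 3 := by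
    unfold N3 at hB
    simpa [Finset.mem_filter, Finset.mem_powerset] using hB
  have hBg : B ⊆ gr M := hB'.1.trans hG'.1
  have hr3 : M.eRk (B : Set α) = ((3 : ℕ) : ℕ∞) := by rw [hB'.2]; rfl
  have hcard3 : 3 ≤ B.card := by
    have h := M.eRk_le_encard (B : Set α)
    rw [hB'.2, Set.encard_coe_eq_coe_finsetCard] at h
    exact_mod_cast h
  unfold wt
  split_ifs with h3 htie
  · -- a triple: `w_∞ ≥ 1/4`
    have := wInf_ge_of_eRk_eq hBg hr3
    norm_num at this
    linarith
  · -- a tie line: `m ≤ 1`, `w_∞ ≥ 1/2`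
    have := wInf_ge_of_succ_le_card hs (by norm_num) hBg hr3 (by omega)
    norm_num at this
    linarith
  · -- no tie line: `m = 0`
    have hm : mTr M B = 0 := by
      by_contra hm
      obtain ⟨y, hyB, hy⟩ := exists_coloop_of_mTr_pos hBg hm
      rw [hB'.2] at hy
      have hr2 : M.eRk ((B.erase y : Finset α) : Set α) = 2 := by
        obtain ⟨k, hk, -⟩ := eRk_eq_nat M (B.erase y)
        rw [hk] at hy ⊢
        have hk' : ((k + 1 : ℕ) : ℕ∞) = ((3 : ℕ) : ℕ∞) := by push_cast; exact hy
        have := (Nat.cast_inj (R := ℕ∞)).1 hk'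
        exact_mod_cast (by omega : k = 2)
      obtain ⟨hℓ, hsub⟩ := clF_mem_lines ((Finset.erase_subset y B).trans hBg) hr2
      -- the line lies in the plane
      have hℓG : clF M (B.erase y) ⊆ G := by
        intro z hz
        rw [mem_clF] at hz
        have : z ∈ M.closure (G : Set α) :=
          M.closure_subset_closure (Finset.coe_subset.2 ((Finset.erase_subset y B).trans hB'.1)) hz
        rw [hG'.2.1.closure] at this
        exact_mod_cast this
      -- `y ∉ ℓ`, so `ℓ ∩ B = B ∖ {y}`
      have hyℓ : y ∉ clF M (B.erase y) := by
        rw [mem_clF]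
        -- `y` is a coloop: `y ∉ cl(B ∖ y)`
        have hy' : M.eRk ((insert y (B.erase y) : Finset α) : Set α) = M.eRk ((B.erase y : Finset α) : Set α) + 1 := by
          rw [Finset.insert_erase hyB, hB'.2, hr2]
          rfl
        intro hmem
        have : M.eRk ((insert y (B.erase y) : Finset α) : Set α) = M.eRk ((B.erase y : Finset α) : Set α) := by
          rw [Finset.coe_insert, ← M.eRk_closure_eq (insert y _),
            Matroid.closure_insert_eq_of_mem_closure hmem, M.eRk_closure_eq]
        rw [this, hr2] at hy'
        exact absurd hy' (by decide)
      have hinter : clF M (B.erase y) ∩ B = B.erase y := by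
        ext z
        rw [Finset.mem_inter, Finset.mem_erase]
        constructor
        · rintro ⟨hz1, hz2⟩
          refine ⟨fun hzy => hyℓ (hzy ▸ hz1), hz2⟩
        · rintro ⟨hzy, hz⟩
          exact ⟨hsub (Finset.mem_erase.2 ⟨hzy, hz⟩), hz⟩
      apply htie
      refine ⟨clF M (B.erase y), ?_⟩
      unfold tieLines
      rw [Finset.mem_filter]
      refine ⟨hℓ, hℓG, ?_⟩
      rw [hinter, Finset.card_erase_of_mem hyB]
      omega
    unfold wInf
    rw [hm]
    norm_num

/-- `G` and the `G ∖ {a}` with `ρ(G ∖ {a}) = 3` are demand-free at type `2`: `1 + g′ ≤ DF₂`. -/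
theorem one_add_gp_le_DFq_two {G : Finset α} (hG : G ∈ planes M) : 1 + gp M G ≤ DFq M G 3 2 := by
  classical
  have hG' := mem_planes.1 hG
  unfold DFq gp
  rw [Rq_three_eq_N3]
  have hmem : ∀ a ∈ G.filter (fun a => M.eRk ((G.erase a : Finset α) : Set α) = 3),
      G.erase a ∈ (N3 M G).filter (fun B => M.eRk ((G \ B : Finset α) : Set α) + 1 ≤ ((2 : ℕ) : ℕ∞)) := by
    intro a ha
    rw [Finset.mem_filter] at ha
    rw [Finset.mem_filter]
    refine ⟨?_, ?_⟩
    · unfold N3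
      rw [Finset.mem_filter, Finset.mem_powerset]
      exact ⟨Finset.erase_subset a G, ha.2⟩
    · have hsub : G \ G.erase a ⊆ {a} := by
        intro z hz
        rw [Finset.mem_sdiff, Finset.mem_erase] at hz
        rw [Finset.mem_singleton]
        by_contra hza
        exact hz.2 ⟨hza, hz.1⟩
      have h1 : M.eRk ((G \ G.erase a : Finset α) : Set α) ≤ 1 := by
        have h := M.eRk_le_encard ((G \ G.erase a : Finset α) : Set α)
        rw [Set.encard_coe_eq_coe_finsetCard] at h
        have hc : (G \ G.erase a).card ≤ 1 := by
          have := Finset.card_le_card hsub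
          rwa [Finset.card_singleton] at this
        calc M.eRk ((G \ G.erase a : Finset α) : Set α) ≤ ((G \ G.erase a).card : ℕ∞) := h
          _ ≤ 1 := by exact_mod_cast hc
      calc M.eRk ((G \ G.erase a : Finset α) : Set α) + 1 ≤ 1 + 1 := by gcongr
        _ = ((2 : ℕ) : ℕ∞) := by norm_num
  have hGmem : G ∈ (N3 M G).filter (fun B => M.eRk ((G \ B : Finset α) : Set α) + 1 ≤ ((2 : ℕ) : ℕ∞)) := by
    rw [Finset.mem_filter]
    refine ⟨?_, ?_⟩
    · unfold N3
      rw [Finset.mem_filter, Finset.mem_powerset]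
      exact ⟨subset_refl G, hG'.2.2⟩
    · rw [Finset.sdiff_self, Finset.coe_empty, M.eRk_empty]
      norm_num
  have hinj : Set.InjOn (fun a => G.erase a)
      ((G.filter (fun a => M.eRk ((G.erase a : Finset α) : Set α) = 3) : Finset α) : Set α) := by
    intro a ha b hb hab
    rw [Finset.mem_coe, Finset.mem_filter] at ha hb
    simp only at hab
    by_contra hne
    have : a ∈ G.erase b := Finset.mem_erase.2 ⟨hne, ha.1⟩
    rw [← hab, Finset.mem_erase] at this
    exact this.1 rfl
  have hGnot : G ∉ (G.filter (fun a => M.eRk ((G.erase a : Finset α) : Set α) = 3)).image (fun a => G.erase a) := by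
    rw [Finset.mem_image]
    rintro ⟨a, ha, hGa⟩
    rw [Finset.mem_filter] at ha
    have : a ∈ G.erase a := by rw [hGa]; exact ha.1
    exact (Finset.mem_erase.1 this).1 rfl
  have hsub : insert G ((G.filter (fun a => M.eRk ((G.erase a : Finset α) : Set α) = 3)).image (fun a => G.erase a)) ⊆
      (N3 M G).filter (fun B => M.eRk ((G \ B : Finset α) : Set α) + 1 ≤ ((2 : ℕ) : ℕ∞)) := by
    intro B hB
    rw [Finset.mem_insert, Finset.mem_image] at hB
    rcases hB with rfl | ⟨a, ha, rfl⟩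
    · exact hGmem
    · exact hmem a ha
  have h := Finset.card_le_card hsub
  rw [Finset.card_insert_of_notMem hGnot, Finset.card_image_of_injOn hinj] at h
  omega

/-- **The type-`2` balance on every plane of a simple matroid** — Theorem O's `(β)` in the vocabulary of the
general balance. -/
theorem Jq_two_nonneg_plane (hs : Simple M) {G : Finset α} (hG : G ∈ planes M) : 0 ≤ Jq M G 3 2 := by
  classical
  have hβ := beta_ineq hs hG
  have hN := card_N3_eq M G
  have hDF := one_add_gp_le_DFq_two (M := M) hG
  have hsup : ∑ B ∈ N3 M G, wt M G B ≤ ∑ B ∈ N3 M G, wInf M B :=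
    Finset.sum_le_sum (fun B hB => wt_le_wInf hs hG hB)
  rw [sum_wt_eq] at hsup
  unfold Jq Nq
  rw [Rq_three_eq_N3]
  have e : ∑ B ∈ N3 M G, (((3 : ℕ) : ℚ) + 2 - ((2 : ℕ) : ℚ)) * wInf M B = 3 * ∑ B ∈ N3 M G, wInf M B := by
    rw [Finset.mul_sum]
    apply Finset.sum_congr rfl
    intro B _
    push_cast
    ring
  rw [e]
  have hN' : ((N3 M G).card : ℚ) = Tc M G + LPc M G + Rc M G := by exact_mod_cast hN
  have hDF' : (1 : ℚ) + gp M G ≤ DFq M G 3 2 := by exact_mod_cast hDF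
  rw [hN']
  push_cast
  nlinarith [hβ, hsup, hDF']

/-! ## The type-`1` balance for `g ≤ q + 1` at every `q` -/

/-- **The type-`1` balance for `g ≤ q + 1`**: at most `q + 1` independent `q`-sets (deficit `1/(q + 1)` each)
against the surplus `1/(q + 1)` of the demand-free `G`. -/
theorem Jq_one_nonneg_of_card_le_succ (hs : Simple M) {G : Finset α} {q : ℕ} (hG : G ⊆ gr M)
    (hr : M.eRk (G : Set α) = (q : ℕ∞)) (hq : 2 ≤ q) (hg : G.card ≤ q + 1) : 0 ≤ Jq M G q 1 := by
  classical
  set I := (Rq M G q).filter (fun B : Finset α => B.card = q) with hI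
  set Rb := (Rq M G q).filter (fun B : Finset α => ¬ B.card = q) with hRb
  have hN : (Nq M G q : ℚ) = (I.card : ℚ) + (Rb.card : ℚ) := by
    rw [hI, hRb]
    unfold Nq
    exact_mod_cast (Finset.card_filter_add_card_filter_not _).symm
  -- at most `q + 1` independent `q`-sets
  have hIle : I.card ≤ q + 1 := by
    have h1 : I ⊆ G.powersetCard q := by
      intro B hB
      rw [hI, Finset.mem_filter, mem_Rq] at hB
      rw [Finset.mem_powersetCard]
      exact ⟨hB.1.1, hB.2⟩
    have h2 := Finset.card_le_card h1
    rw [Finset.card_powersetCard] at h2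
    have hgq : q ≤ G.card := by
      have h4 := M.eRk_le_encard (G : Set α)
      rw [hr, Set.encard_coe_eq_coe_finsetCard] at h4
      exact_mod_cast h4
    rcases (show G.card = q ∨ G.card = q + 1 by omega) with h | h
    · rw [h, Nat.choose_self] at h2
      omega
    · rw [h, Nat.choose_succ_self_right] at h2
      exact h2
  have hq' : (2 : ℚ) ≤ q := by exact_mod_cast hq
  have hq1 : (0 : ℚ) < (q : ℚ) - 1 := by linarith
  have hI1 : (I.card : ℚ) * 1 ≤ ∑ B ∈ I, ((q : ℚ) + 2 - (1 : ℕ)) * wInf M B := by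
    rw [← nsmul_eq_mul]
    apply Finset.card_nsmul_le_sum
    intro B hB
    rw [hI, Finset.mem_filter, mem_Rq] at hB
    have hw := wInf_ge_of_eRk_eq (hB.1.1.trans hG) hB.1.2
    calc (1 : ℚ) = ((q : ℚ) + 1) * (1 / ((q : ℚ) + 1)) := by field_simp
      _ ≤ ((q : ℚ) + 1) * wInf M B := by gcongr
      _ = ((q : ℚ) + 2 - (1 : ℕ)) * wInf M B := by push_cast; ring
  have hR1 : (Rb.card : ℚ) * (((q : ℚ) + 1) / ((q : ℚ) - 1)) ≤
      ∑ B ∈ Rb, ((q : ℚ) + 2 - (1 : ℕ)) * wInf M B := by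
    rw [← nsmul_eq_mul]
    apply Finset.card_nsmul_le_sum
    intro B hB
    rw [hRb, Finset.mem_filter, mem_Rq] at hB
    have hcard : q + 1 ≤ B.card := by
      have h4 := M.eRk_le_encard (B : Set α)
      rw [hB.1.2, Set.encard_coe_eq_coe_finsetCard] at h4
      have h4' : q ≤ B.card := by exact_mod_cast h4
      omega
    have hw := wInf_ge_of_succ_le_card hs (by omega) (hB.1.1.trans hG) hB.1.2 hcard
    calc ((q : ℚ) + 1) / ((q : ℚ) - 1) = ((q : ℚ) + 1) * (1 / ((q : ℚ) - 1)) := by ring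
      _ ≤ ((q : ℚ) + 1) * wInf M B := by gcongr
      _ = ((q : ℚ) + 2 - (1 : ℕ)) * wInf M B := by push_cast; ring
  have hsplit : ∑ B ∈ Rq M G q, ((q : ℚ) + 2 - (1 : ℕ)) * wInf M B =
      ∑ B ∈ I, ((q : ℚ) + 2 - (1 : ℕ)) * wInf M B + ∑ B ∈ Rb, ((q : ℚ) + 2 - (1 : ℕ)) * wInf M B := by
    rw [hI, hRb]
    exact (Finset.sum_filter_add_sum_filter_not _ _ _).symm
  have hDF : (1 : ℚ) ≤ (DFq M G q 1 : ℚ) := by exact_mod_cast one_le_DFq_one hr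
  have hIle' : (I.card : ℚ) ≤ (q : ℚ) + 1 := by exact_mod_cast hIle
  have hR0 : (0 : ℚ) ≤ Rb.card := by positivity
  have hΦ : (0 : ℚ) ≤ ((q : ℚ) + 2) / ((q : ℚ) + 1) := by positivity
  have hmono : (((q : ℚ) + 2) / ((q : ℚ) + 1)) * ((I.card : ℚ) + (Rb.card : ℚ) - (DFq M G q 1 : ℚ)) ≤
      (((q : ℚ) + 2) / ((q : ℚ) + 1)) * ((I.card : ℚ) + (Rb.card : ℚ) - 1) := by
    apply mul_le_mul_of_nonneg_left _ hΦ
    linarith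
  have key : (0 : ℚ) ≤ (I.card : ℚ) * 1 + (Rb.card : ℚ) * (((q : ℚ) + 1) / ((q : ℚ) - 1)) -
      (((q : ℚ) + 2) / ((q : ℚ) + 1)) * ((I.card : ℚ) + (Rb.card : ℚ) - 1) := by
    have e : (I.card : ℚ) * 1 + (Rb.card : ℚ) * (((q : ℚ) + 1) / ((q : ℚ) - 1)) -
        (((q : ℚ) + 2) / ((q : ℚ) + 1)) * ((I.card : ℚ) + (Rb.card : ℚ) - 1) =
        ((Rb.card : ℚ) * ((q : ℚ) + 3) + ((q : ℚ) + 2) * ((q : ℚ) - 1) - (I.card : ℚ) * ((q : ℚ) - 1)) /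
          (((q : ℚ) + 1) * ((q : ℚ) - 1)) := by
      field_simp
      ring
    rw [e]
    apply div_nonneg
    · nlinarith
    · positivity
  unfold Jq
  rw [hsplit, hN]
  set a : ℚ := ((q : ℚ) + 1) / ((q : ℚ) - 1) with ha
  set Φ : ℚ := ((q : ℚ) + 2) / ((q : ℚ) + 1) with hΦdef
  set SI := ∑ B ∈ I, ((q : ℚ) + 2 - (1 : ℕ)) * wInf M B with hSI
  set SR := ∑ B ∈ Rb, ((q : ℚ) + 2 - (1 : ℕ)) * wInf M B with hSR
  linarith [hI1, hR1, key, hmono]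

/-! ## Level `3` is closed -/

/-- **Every plane of a simple matroid satisfies the balances of the types `t ≤ 2`** (the flats-only level-`3`
residue, discharged): `t = 0` for every set, `t = 1` by the threshold `g ≥ 5` or the small cases `g ≤ 4`, `t = 2`
by Theorem O's `(β)`. -/
theorem perFlatBelowFlat_three (hs : Simple M) {G : Finset α} (hG : G ∈ flatsQ M 3) :
    ∀ t, t + 1 ≤ 3 → 0 ≤ Jq M G 3 t := by
  intro t ht
  rw [flatsQ_three] at hG
  have hG' := mem_planes.1 hG
  have hr : M.eRk (G : Set α) = ((3 : ℕ) : ℕ∞) := by rw [hG'.2.2]; rfl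
  rcases (show t = 0 ∨ t = 1 ∨ t = 2 by omega) with rfl | rfl | rfl
  · exact Jq_zero_nonneg hG'.1 3
  · by_cases hg : G.card ≤ 4
    · exact Jq_one_nonneg_of_card_le_succ hs hG'.1 hr (by norm_num) hg
    · exact Jq_one_nonneg hs hG'.1 hr (by norm_num) (by omega)
  · exact Jq_two_nonneg_plane hs hG

end PercRepro.GenQ
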